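import Summits.BirchSwinnertonDyer.BirchSwinnertonDyer.Theorems.SylvesterTwoHeegnerIndexTwoAdicPairEngine
import Literature.NumberTheory.EllipticCurves.HuShuYin2019.SylvesterHeegnerHeightDisplay
import HarnessLib

/-!
# Route `SylvesterTwoHeegnerIndex` (rung K7t), item 19580 `TwoAdicPairHSY`:
# the CLASS-WIDE PARITY `ord₂(#Ш_an(E_p)·#Ш_an(E_{3p²})) ∈ 2ℤ` from Hu–Shu–Yin's display (bsd)

HONEST FRAMING (cell b2b-bsdres, seat x1b GEN 48 = O12 class lead; `--supports
stmt-BirchSwinnertonDyer-19580`; planner ruling D104 (bsd-cm, 2026-08-26T10:19Z): x1b writes the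
PARITY layer (F1)–(F4), bsd-cm-two writes the non-negativity layer and the assembly to `TwoAdicPairHSY`
importing these declarations BY NAME). Item 19580 asks, for every member `B ≅ E_p` of 𝒞_HSY and
every minimal partner `A ≅ E_{3p²}`, that `#Ш_an(B)`, `#Ш_an(A)` be rational with non-zero product
and `ord₂(#Ш_an(B)·#Ш_an(A)) = 2n` with `n : ℕ`. It is OPEN and STAYS OPEN here (nothing is closed).
This file is (F4): the PARITY HALF (`n : ℤ`) FOR EVERY MEMBER, conditional on exactly ONE cited fact
and on nothing else —

* (F3) `Literature.NumberTheory.EllipticCurves.HuShuYin2019.shaAnPair_mul_height_eq_two_zpow_mul_height`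
  (`Literature/NumberTheory/EllipticCurves/HuShuYin2019/SylvesterHeegnerHeightDisplay.lean`): the
  display (bsd) of [HuShuYin2019] p. 12 — derived there from the explicit Gross–Zagier formula
  Thm. 4.3 / Cor. 4.4 and the Tamagawa / torsion / period data of `E_p`, `E_{3p²}` — in the tree's
  currency, with the same binders as `TwoAdicPairHSY`: `∃ qB qA, #Ш_an(B) = qB ∧ #Ш_an(A) = qA ∧
  qB·qA ≠ 0 ∧ rank_ℤ B(K) = 2 ∧ ∃ P Y, … ∧ (qB·qA)·ĥ_K(ιP) = 2^i·ĥ_K(Y)` (`i = 0 | −2` for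
  `p ≡ 4 | 7 (mod 9)`, `P` a generator of `E_p(ℚ)` modulo torsion, `Y ∈ E_p(K)`, `K ∋ ω` quadratic);
* (F4) **`twoAdicPairHSY_parity`** — `fact → ∀ members, ∃ qB qA, #Ш_an(B) = qB ∧ #Ш_an(A) = qA ∧
  qB·qA ≠ 0 ∧ ∃ n : ℤ, ord₂(qB·qA) = 2n`: VERBATIM the body of `TwoAdicPairHSY` with `n : ℤ` for
  `n : ℕ`. PROOF (`2` is INERT in `ℤ[ω]`): instantiate the fact at `K = ℚ(ζ₃)` (`CyclotomicField 3 ℚ`,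
  `ω = ζ₃`, `[K:ℚ] = 2`) and apply the fact-free engine `even_padicValRat_two_of_model`
  (`…TwoAdicPairEngine.lean`: transport to Hu–Shu–Yin's model, `[ω]` = (F1) `exists_omegaRot`, the
  `K`-line from `rank_ℤ = 2`, the Néron–Tate NORM FORM `ĥ(a•X + b•[ω]X) = (a² − ab + b²)·ĥ(X)` of
  `…CMNormForm.lean`, and `ord₂(a² − ab + b²)` even of `…TwoInertParity.lean`).

The non-negativity `0 ≤ ord₂(qB·qA) − i(p)` (odd-index lemma; for `p ≡ 7 (mod 9)` modulo memo Thm C)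
and the assembly to `TwoAdicPairHSY` are bsd-cm-two's files (`…Theorems.SylvesterTwoNonneg.*`,
p442958 / p443559 / p443851 / p444380), by the planner's ruling D104; x1b's fact-free duplicates of
that layer (`…TwoAdicPairOddIndex.lean`, `…TwoAdicPairDescentEngine.lean`) are helpers only.

WHAT THIS IS NOT: not 19580 (the `2`-integrality half is not in this file); not a claim about `Ш`; the
cited fact is an `∃`-weakening of a printed explicit construction (`TODO(general form)` recorded in
its docstring); nothing booked, no label / mark / count / tier moves.
References: [HuShuYin2019] Thm. 1.3, (bsd1) p. 3, p. 8, Thm. 4.3 / Cor. 4.4 p. 11, (bsd) p. 12;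
[SilvermanAEC2009] III.3.1(b), VIII.9.1, VIII.9.3.
-/

set_option autoImplicit false
-- the Summit-side namespace `Summit.BirchSwinnertonDyer.BirchSwinnertonDyer.…` (summit = problem) is mandated by D-0017
set_option linter.dupNamespace false

noncomputable section

open scoped Classical

open WeierstrassCurve WeierstrassCurve.Affine WeierstrassCurve.Affine.Point
  Literature.NumberTheory.EllipticCurves Literature.NumberTheory.EllipticCurves.HuShuYin2019
  Summit.BirchSwinnertonDyer.BirchSwinnertonDyer.Theses.SylvesterTwoHeegnerIndex

namespace Summit.BirchSwinnertonDyer.BirchSwinnertonDyer.Theorems.SylvesterTwoCMNormForm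

/-! ## §12 The parity for every member -/

section Parity

/-- **THE CLASS-WIDE PARITY OF `TwoAdicPairHSY` (item 19580), modulo Hu–Shu–Yin's display (bsd).**
For every prime `p ≡ 4, 7 (mod 9)` with `3 ∉ 𝔽_p^{×3}`, every globally minimal `B ≅ E_p` and
`A ≅ E_{3p²}`: `#Ш_an(B), #Ш_an(A)` are rational, their product is non-zero, and
`ord₂(#Ш_an(B)·#Ш_an(A))` is EVEN — verbatim the body of `TwoAdicPairHSY` with `n : ℤ` in place of
`n : ℕ`. Proof: over `K = ℚ(ζ₃)`, `#Ш_an(B)·#Ш_an(A) = 2^i·ĥ(Y)/ĥ(P)` (the fact), `Y ∈ K·P` with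
`ĥ([(a + bω)/n]P) = (a² − ab + b²)/n²·ĥ(P)` (the CM norm form), and `ord₂(a² − ab + b²)` is even
because `2` is INERT in `ℤ[ω]`; `i ∈ {0, −2}` is even. [cite: HuShuYin2019, display (bsd) p. 12] -/
theorem twoAdicPairHSY_parity (hH : shaAnPair_mul_height_eq_two_zpow_mul_height) :
    ∀ (p : ℕ), p.Prime → (p % 9 = 4 ∨ p % 9 = 7) → (¬ ∃ x : ZMod p, x ^ 3 = 3) →
      ∀ (A B : WeierstrassCurve ℚ) [A.IsElliptic] [A.IsGloballyMinimal]
        [B.IsElliptic] [B.IsGloballyMinimal],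
        (∃ C : VariableChange ℚ, C • B = cubeSumCurve (p : ℚ)) →
        (∃ C : VariableChange ℚ, C • A = cubeSumCurve (3 * (p : ℚ) ^ 2)) →
        ∃ qB qA : ℚ, shaAn B = (qB : ℂ) ∧ shaAn A = (qA : ℂ) ∧ qB * qA ≠ 0 ∧
          ∃ n : ℤ, padicValRat 2 (qB * qA) = 2 * n := by
  intro p hp h9 h3 A B _ _ _ _ hB hA
  -- the field `K = ℚ(ζ₃)` and `ω = ζ₃`
  haveI hcyc : IsCyclotomicExtension {3} ℚ (CyclotomicField 3 ℚ) :=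
    CyclotomicField.isCyclotomicExtension 3 ℚ
  have hω : (IsCyclotomicExtension.zeta 3 ℚ (CyclotomicField 3 ℚ)) ^ 2 +
      IsCyclotomicExtension.zeta 3 ℚ (CyclotomicField 3 ℚ) + 1 = 0 :=
    sq_add_self_add_one_eq_zero_of_isPrimitiveRoot
      (IsCyclotomicExtension.zeta_spec 3 ℚ (CyclotomicField 3 ℚ))
  obtain ⟨qB, qA, hqB, hqA, hne, hrank, P, Y, hP, -, hid⟩ :=
    hH p hp h9 h3 A B hB hA (CyclotomicField 3 ℚ) _ hω finrank_cyclotomicField_three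
  obtain ⟨C, hC⟩ := hB
  have hi : Even (if p % 9 = 4 then (0 : ℤ) else -2) := by
    split_ifs
    · exact ⟨0, rfl⟩
    · exact ⟨-1, rfl⟩
  obtain ⟨r, hr⟩ := even_padicValRat_two_of_model hω B C hC hrank hP Y hne hi hid
  exact ⟨qB, qA, hqB, hqA, hne, r, by rw [hr]; ring⟩

end Parity

end Summit.BirchSwinnertonDyer.BirchSwinnertonDyer.Theorems.SylvesterTwoCMNormForm

end
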